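import Summits.QuantumFields.BalabanUV.Beta.BorderedHessianSymmetry
import Summits.QuantumFields.BalabanUV.Beta.BorderedHessianKernelAction

/-!
# `GAN24.ContactOneGaugeCellMaxwell` — CT-ROUTE step CT-3a, part 1b: THE MAXWELL CONTRACTION of the `d*d` matrix column against ANY 1-form,
# `Σ'_z Σ_β T β z · (d*d δ_{(κ′,u)})_β(z) = (d*d T)_{κ′}(u)`, and its two `cube 2` window forms

HONEST FRAMING (cell charter, verbatim): «discharging `BetaPertH` makes Bałaban's UV stability UNCONDITIONAL — a real constructive-QFT result;
it is NOT the continuum limit and NOT the Clay problem.»  DERIVED cell leaf (pub-balaban, G-an2-4 formalisation swarm → CRUX TEAM (2), seat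
`b2b-balaban-gan24-formalise-leaf-02`, gen 46; module CT-3a of the row owner's `CT3-MECHANISM.md` v1∕v1.1 §3): finitely supported lattice sums over an2's
`d*d = curvAdj ∘ curv` matrix (`BorderedHessian.curvAdj_curv_eq_window_sum` ∕ `curvAdj_curv_delta1_eq_zero` ∕ `curvAdj_curv_delta1_symm` BY NAME); NO estimate,
nothing cited — every statement is kernel-proved ([folklore] = standard finite algebra); no `[cite:]` tag, no `def`, no `def … : Prop`; it instantiates NO binder
of the β-function wall and discharges NO letter of (CONV-C).  NEVER «G-an2-4 closed»; NOT hS0, NOT D1, NOT `BetaPertH`, NOT continuum, NOT Clay.  «our bookkeeping».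
HONEST DEPENDENCY (cell records, verbatim): «continuum YM on T⁴ ⇐ BetaPertH ∧ nine spine estimates (0/9 proved); BetaPertH ⇐ (D1) ∧ (D4) ∧ CAP+tail;
G-an2-4 gates asym, D1 and NE2/3/4.»
ABSOLUTE RULE (cell charter, verbatim): «No internally-minted statement may enter as a cited fact. Every hypothesis is either kernel-proved in this
package or a verbatim quotation of a PUBLISHED theorem with page reference. The manuscript(s) under audit are NOT citable for their own disputed steps —
they are the thing under adjudication; programme-internal (2001/route/tribunal) claims are never citable.»

WHAT IS PROVED (generic `d`, on `ℤ^(d+1)`): `delta1_eq_trans1`, **`curvAdj_curv_delta1_translate`** (`(d*d δ_{(κ′,u)})_β(u+v) = (d*d δ_{(κ′,0)})_β(v)`),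
`curvAdj_curv_delta1_eq_zero_of_not_mem` (window `cube 2`), `sum_window_mul_curvAdj_curv_delta1`, `summable_mul_curvAdj_curv_delta1`,
**`tsum_mul_curvAdj_curv_delta1`** (`Σ'_z Σ_β T β z·(d*d δ_{(κ′,u)})_β z = (d*d T)_{κ′} u` for EVERY 1-form `T`: the `cube 2` window of the matrix makes the sum finite,
its symmetry moves the Maxwell operator onto `T`), **`tsum_mul_curvAdj_curv_delta1_eq_window`** (any 1-form `m` against the matrix column = a `cube 2` window sum with the
translated entries `(d*d δ_{(κ′,0)})_β v` — the form in which a bounded weight rides along) and its dual **`sum_window_curvAdj_curv_delta1_mul_sub`**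
(`Σ_{v ∈ cube 2} Σ_{κ′} (d*d δ_{(κ′,0)})_β v·T κ′ (z − v) = (d*d T)_β z`) — the two window forms between which part 2 (`GAN24.ContactOneGaugeCell`) swaps the index-leg
and table-leg sums of the one-gauge contact cell.
Provenance: seat b2b-balaban-gan24-formalise-leaf-02 gen 46 (prover-…-leaf-02-g46-0), 2026-08-21; over the files named above BY NAME.
-/

namespace Summit.QuantumFields.BalabanUV.Beta.GAN24.ContactOneGaugeCellMaxwell

open Finset
open scoped BigOperators
open Literature.MathematicalPhysics.QuantumFieldTheory.Balaban1983to89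
open Literature.MathematicalPhysics.QuantumFieldTheory.Balaban1983to89.Beta
open AffineAveraging (Form1 curv curvAdj)
open AffineReproduction (trans1 trans1_apply curvAdj_curv_trans1)
open KKTFluctuationKernel (delta1 delta1_apply)
open Summit.QuantumFields.BalabanUV.Beta.AxialDressingRooted (cube mem_cube zero_mem_cube tsum_window tsum_window')
open Summit.QuantumFields.BalabanUV.Beta.BorderedHessian (curvAdj_curv_eq_window_sum curvAdj_curv_delta1_eq_zero curvAdj_curv_delta1_symm)

noncomputable section

variable {d : ℕ}

/-! ## The Maxwell contraction: `Σ_{(β,z)} T β z · (d*d δ_{(κ′,u)})_β(z) = (d*d T)_{κ′}(u)` -/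

section Maxwell

/-- [folklore] A point source translated: `δ_{(κ′,u)} = trans1 (−u) δ_{(κ′,0)}`. -/
theorem delta1_eq_trans1 (κ' : Fin (d + 1)) (u : Fin (d + 1) → ℤ) : delta1 κ' u = trans1 (-u) (delta1 κ' 0) := by
  funext κ x
  simp only [trans1_apply, delta1_apply, add_neg_eq_zero]

/-- [folklore] **TRANSLATION INVARIANCE OF THE `d*d` MATRIX**: `(d*d δ_{(κ′,u)})_β(u + v) = (d*d δ_{(κ′,0)})_β(v)`. -/
theorem curvAdj_curv_delta1_translate (κ' β : Fin (d + 1)) (u v : Fin (d + 1) → ℤ) :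
    curvAdj (curv (delta1 κ' u)) β (u + v) = curvAdj (curv (delta1 κ' 0)) β v := by
  rw [delta1_eq_trans1, curvAdj_curv_trans1, trans1_apply, add_neg_cancel_comm]

/-- [folklore] **THE `d*d` MATRIX HAS WINDOW `cube 2`**: `(d*d δ_{(κ′,u)})_β(z) = 0` unless `z − u ∈ cube 2` (an2's
`curvAdj_curv_delta1_eq_zero` through the matrix symmetry `curvAdj_curv_delta1_symm`). -/
theorem curvAdj_curv_delta1_eq_zero_of_not_mem {κ' β : Fin (d + 1)} {u z : Fin (d + 1) → ℤ} (h : z - u ∉ cube (d + 1) 2) :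
    curvAdj (curv (delta1 κ' u)) β z = 0 := by
  rw [curvAdj_curv_delta1_symm]
  exact curvAdj_curv_delta1_eq_zero h κ' β

/-- [folklore] **THE MAXWELL CONTRACTION AS A WINDOW SUM**: `Σ_{v ∈ cube 2} Σ_β T β (u+v)·(d*d δ_{(κ′,u)})_β(u+v) = (d*d T)_{κ′}(u)`
(an2's representation `curvAdj_curv_eq_window_sum` + the matrix symmetry). -/
theorem sum_window_mul_curvAdj_curv_delta1 (T : Form1 (d + 1) ℝ) (κ' : Fin (d + 1)) (u : Fin (d + 1) → ℤ) :
    (∑ v ∈ cube (d + 1) 2, ∑ β, T β (u + v) * curvAdj (curv (delta1 κ' u)) β (u + v)) = curvAdj (curv T) κ' u := by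
  rw [curvAdj_curv_eq_window_sum T κ' u]
  refine Finset.sum_congr rfl fun v _ => Finset.sum_congr rfl fun β _ => ?_
  rw [curvAdj_curv_delta1_symm, mul_comm]

/-- [folklore] The Maxwell-contracted summand is finitely supported, hence summable, for EVERY 1-form `T`. -/
theorem summable_mul_curvAdj_curv_delta1 (T : Form1 (d + 1) ℝ) (κ' : Fin (d + 1)) (u : Fin (d + 1) → ℤ) :
    Summable fun z => ∑ β, T β z * curvAdj (curv (delta1 κ' u)) β z := by
  classical
  refine summable_of_ne_finset_zero (s := (cube (d + 1) 2).image fun v => u + v) fun z hz => ?_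
  have hz' : z - u ∉ cube (d + 1) 2 := fun h => hz (Finset.mem_image.2 ⟨z - u, h, by abel⟩)
  exact Finset.sum_eq_zero fun β _ => by rw [curvAdj_curv_delta1_eq_zero_of_not_mem hz', mul_zero]

/-- [folklore] **THE MAXWELL CONTRACTION**: for EVERY 1-form `T` on `ℤ^(d+1)`, every index bond `(κ′,u)`,
`Σ'_z Σ_β T β z · (d*d δ_{(κ′,u)})_β(z) = (d*d T)_{κ′}(u)` — the window `cube 2` of the `d*d` matrix makes the sum finite; its symmetry moves
the Maxwell operator onto `T`. -/
theorem tsum_mul_curvAdj_curv_delta1 (T : Form1 (d + 1) ℝ) (κ' : Fin (d + 1)) (u : Fin (d + 1) → ℤ) :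
    ∑' z, ∑ β, T β z * curvAdj (curv (delta1 κ' u)) β z = curvAdj (curv T) κ' u := by
  have hwin : ∀ z, (∑ β, T β z * curvAdj (curv (delta1 κ' u)) β z) =
      if z - u ∈ cube (d + 1) 2 then ∑ β, T β z * curvAdj (curv (delta1 κ' u)) β z else 0 := by
    intro z
    split_ifs with h
    · rfl
    · exact Finset.sum_eq_zero fun β _ => by rw [curvAdj_curv_delta1_eq_zero_of_not_mem h, mul_zero]
  rw [tsum_congr hwin, tsum_window 2 u, sum_window_mul_curvAdj_curv_delta1]

/-- [folklore] **THE CONTRACTION AGAINST ANY 1-FORM AS A WINDOW SUM** (translated entries): for EVERY `m`,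
`Σ'_z Σ_β m β z·(d*d δ_{(κ′,u)})_β z = Σ_{v ∈ cube 2} Σ_β (d*d δ_{(κ′,0)})_β v · m β (u + v)` — the form in which a bounded weight rides along. -/
theorem tsum_mul_curvAdj_curv_delta1_eq_window (m : Form1 (d + 1) ℝ) (κ' : Fin (d + 1)) (u : Fin (d + 1) → ℤ) :
    ∑' z, ∑ β, m β z * curvAdj (curv (delta1 κ' u)) β z =
      ∑ v ∈ cube (d + 1) 2, ∑ β, curvAdj (curv (delta1 κ' 0)) β v * m β (u + v) := by
  have hwin : ∀ z, (∑ β, m β z * curvAdj (curv (delta1 κ' u)) β z) =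
      if z - u ∈ cube (d + 1) 2 then ∑ β, m β z * curvAdj (curv (delta1 κ' u)) β z else 0 := by
    intro z
    split_ifs with h
    · rfl
    · exact Finset.sum_eq_zero fun β _ => by rw [curvAdj_curv_delta1_eq_zero_of_not_mem h, mul_zero]
  rw [tsum_congr hwin, tsum_window 2 u]
  refine Finset.sum_congr rfl fun v _ => Finset.sum_congr rfl fun β _ => ?_
  rw [curvAdj_curv_delta1_translate, mul_comm]

/-- [folklore] **THE DUAL WINDOW CONTRACTION** (the index leg summed against the translated entries, read at `z − v`): for EVERY 1-form `T`,
`Σ_{v ∈ cube 2} Σ_{κ′} (d*d δ_{(κ′,0)})_β v · T κ′ (z − v) = (d*d T)_β(z)`. -/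
theorem sum_window_curvAdj_curv_delta1_mul_sub (T : Form1 (d + 1) ℝ) (β : Fin (d + 1)) (z : Fin (d + 1) → ℤ) :
    (∑ v ∈ cube (d + 1) 2, ∑ κ', curvAdj (curv (delta1 κ' 0)) β v * T κ' (z - v)) = curvAdj (curv T) β z := by
  -- the translated entry is the `(β,z)`-column entry of the matrix read at `z − v`
  have hent : ∀ v κ', curvAdj (curv (delta1 κ' 0)) β v = curvAdj (curv (delta1 β z)) κ' (z - v) := by
    intro v κ'
    rw [← curvAdj_curv_delta1_translate κ' β (z - v) v, sub_add_cancel, curvAdj_curv_delta1_symm]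
  have hwin : ∀ u, (∑ κ', T κ' u * curvAdj (curv (delta1 β z)) κ' u) =
      if z - u ∈ cube (d + 1) 2 then ∑ κ', T κ' u * curvAdj (curv (delta1 β z)) κ' u else 0 := by
    intro u
    split_ifs with h
    · rfl
    · exact Finset.sum_eq_zero fun κ' _ => by rw [curvAdj_curv_delta1_eq_zero h κ' β, mul_zero]
  calc (∑ v ∈ cube (d + 1) 2, ∑ κ', curvAdj (curv (delta1 κ' 0)) β v * T κ' (z - v))
      = ∑ v ∈ cube (d + 1) 2, ∑ κ', T κ' (z - v) * curvAdj (curv (delta1 β z)) κ' (z - v) :=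
        Finset.sum_congr rfl fun v _ => Finset.sum_congr rfl fun κ' _ => by rw [hent, mul_comm]
    _ = ∑' u, ∑ κ', T κ' u * curvAdj (curv (delta1 β z)) κ' u := by
        rw [tsum_congr hwin, tsum_window' 2 z]
    _ = curvAdj (curv T) β z := tsum_mul_curvAdj_curv_delta1 T β z

end Maxwell

end

end Summit.QuantumFields.BalabanUV.Beta.GAN24.ContactOneGaugeCellMaxwell
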